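import Summits.QuantumFields.YangMills.Theorems.UnitScaleTiltProp7BlockCompetitorEnergy
import Summits.QuantumFields.YangMills.Theorems.UnitScaleTiltProp7TorusBlockFibres
import Summits.QuantumFields.YangMills.Theorems.UnitScaleTiltProp7TracePairing
import Summits.QuantumFields.YangMills.Theorems.UnitScaleTiltProp7SPrintDefs
import Literature.MathematicalPhysics.QuantumFieldTheory.Balaban1983to89.T3SectALandauChart
import Literature.MathematicalPhysics.QuantumFieldTheory.Balaban1983to89.B11Thm1LevelZero
import Literature.MathematicalPhysics.QuantumFieldTheory.Balaban1983to89.B8Eq143PlaqExpansion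
import Literature.MathematicalPhysics.QuantumFieldTheory.Balaban1983to89.B8Ineq132
import Literature.MathematicalPhysics.QuantumFieldTheory.Balaban1983to89.B9Eq332AvgCovariance
import HarnessLib

/-!
# Route `UnitScaleTilt`, crux K1 «MinimiserStabilityRegPr» (stmt-QuantumFields-19200), route-R E′, architecture (A′) «HCOW-VIA-Σ» (★★OWNER RULING g28-№13), package P-A4
# «CRUDE SLICE ON PRINT'S SLICE», CURVED — FILE (b-T)₂ «THE COMPETITOR'S ENERGY AT THE TORUS MEMBER»: the bubble competitor built on the `ℤ^d` pullback (px11 g5 (b-ℤ):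
# `G z = φ(z)·R(σ_z)⁻¹ ν(block z)`, `σ_z` the comb transport from the block corner, `ν` the Neumann-corrected block datum) read on the torus as `fC := G ∘ ρ` (`ρ` the cell
# representative of ✓ `Prop7TorusCellRepr`) has FROBENIUS energy `Σ_b Σ_jk |(D^η_V fC)(b)_jk|² ≤ C·Σ_x Σ_jk |f(x)_jk|²` with `C = η⁻²·4·(dA₁ + (2dℓκ₀)²·dB₁)·μ₀²·ℓ^{−d}` —
# ✓ `Prop7BlockCompetitorEnergy.competitor_energy_le_of_datumRow` instantiated at `X := Site`, `E := PBond`, `W := M₂(ℂ)` (operator norm), conjugation transports, from FIVE displayed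
# rows: the bubble rows (sign ∕ boundary layer ∕ gradient `A₁` ∕ square `B₁` per block, ✓ `Prop7BubbleOnBlocks`), the comb-gauge row (κ) (px11 ✓ F2b), and the datum row (px11 (b-ℤ) (N))

Cell `ym3-torus`, width seat `ym3-torus-px19` (gen 5); pens of record px12 g5 02:39:52Z ∕ px11 g5 03:15:50Z ∕ px12 g5 03:00:34Z: (b-T) = px19 (this file), (b-ℤ) = px11 (`G`, `ν`,
`QprimeIter_competitor_eq`, `norm_datum_le`), (a) + F3 = px12 (`div_sq_le_of_combBernsteinRow`: its `hF1` = (a) ∘ [(b-ℤ) coset identity] ∘ [this file's energy]).  The letters `G`, `ν`, `φ`, `ρ`,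
`fC` are FREE symbols with defining hypotheses `hG` (px11's text VERBATIM), `hρ`, `hfC`; the rows are hypotheses in px11's ∕ B-β's texts.  THEOREMS ONLY (0 `def`, 0 `sorry`);
`--supports stmt-QuantumFields-19200 --as helper`, count-neutral.  YM₃ on T³ is a ladder rung (R3), not the Clay problem; nothing here claims `bern_P`, `hcoW`, E′, a stub, the crux,
d = 4 or the mass gap.

WHAT IS PROVED (ns `…Theorems.Prop7CompetitorEnergyMember`).
* §1 torus∕block bookkeeping at the member: `sum_pbond_filter` (bond fibres = site fibres × directions), `cellRepr_shift_apply_self ∕ _of_ne` (coordinates of `ρ(x + e_μ)`),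
  `blockMap_cellRepr_shift_ne_of_emod_eq` (a boundary-layer step CHANGES the block, wrap-around included), `bubble_cellRepr_shift_eq` (`φ(ρ(x+e_μ)) = φ(ρ x + e_μ)` always),
  `sum_fibre_eq_sum_blockSites` (a cell-block fibre of the torus IS `blockSites ℓ y` through `ρ`∕`transl`), `l1_sub_corner_le`.
* §2 ★★★ `competitor_energy_member` — the displayed bound.
HONEST SCOPE.  Bookkeeping + ✓ F1-core; no estimate of print; every analytic input is a displayed row supplied by px11 (F2b, (b-ℤ)) and B-β.

References: T. Bałaban, CMP 96 (1984) 223–250 [Balaban1984PropagatorsII] (§1, (2.7)–(2.12)); CMP 99 (1985) 389–434 [Balaban1985BackgroundPropagators] ((3.18)–(3.23) pp.393–394);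
CMP 98 (1985) 17–51 [Balaban1985Averaging] ((8)–(9) p.18, (78)–(87) pp.30–31); CMP 99 (1985) 75–102 [Balaban1985RegularSpaces] ((1.1) p.76).
-/

set_option autoImplicit false

noncomputable section

open scoped BigOperators Matrix.Norms.L2Operator
open Finset

namespace Summit.QuantumFields.YangMills.Theorems.Prop7CompetitorEnergyMember

open Literature.MathematicalPhysics.QuantumFieldTheory.Balaban1983to89
open Literature.MathematicalPhysics.QuantumFieldTheory.Balaban1983to89.T3ContinuumYM3Torus
open B7Prop1Explicit renaming Site → LSite
open B7Prop1Explicit (e e_apply l1 U1 axialFn gaugeAct hol_mem)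
open B7Eq78Linearization (conjR conjR_apply)
open B10Eq27TorusAxialLog (transl transl_apply transl_add_e pull pull_apply unitsField toUField)
open T3SectALandauChart (covDerivFwdT bgUnits eta eta_pos)
open B11Thm1LevelZero (unitsField_toUField_mem_U1)
open B8Eq143PlaqExpansion (norm_conjR_sub_self_le)
open B8Ineq132 (norm_conjR_le conjR_conjR)
open B9Eq332AvgCovariance (conjR_inv_conjR)
open Literature.MathematicalPhysics.QuantumLattice (blockMap blockBase blockSites mem_blockSites_iff card_blockSites)
open Summit.QuantumFields.YangMills.Theorems.Prop7SPrint (basePt)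
open Summit.QuantumFields.YangMills.Theorems.Prop7TorusCellRepr
open Summit.QuantumFields.YangMills.Theorems.Prop7BlockCompetitorEnergy (competitor_energy_le_of_datumRow)
open Summit.QuantumFields.YangMills.Theorems.Prop7CovariantCoercivity (sum_norm_sq_le_mul_opNorm_sq)

open Summit.QuantumFields.YangMills.Theorems.Prop7TorusBlockFibres

/-! ## §2 ★★★ The competitor's energy at the torus member -/

section Member

/-- real scalars on `M₂(ℂ)` are the real complex scalars. [folklore] -/
theorem real_smul_eq_coe_smul (r : ℝ) (X : Matrix (Fin 2) (Fin 2) ℂ) : r • X = (r : ℂ) • X := by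
  ext i j; simp [Matrix.smul_apply, Complex.real_smul]

/-- ★★★ **THE COMPETITOR'S FROBENIUS ENERGY AT THE TORUS MEMBER.**  `F` a T³ family, run `K`, height `n`, `ℓ = L^{K−n}` (`ℓ ∣ N = sitesPerDir 0`, `2ℓ ≤ N`), background `U₀`
read in units `V = bgUnits U₀` with pullback `Ṽ = pull V basePt`; `ρ` the cell representative at `basePt`; a bubble `φ` on `ℤ^d` with the displayed rows (sign, boundary layer,
per-block gradient `A₁` in every direction, per-block square mass `B₁`); the comb-gauge row (κ) `‖(σ•Ṽ)(z, μ) − 1‖ ≤ l1(z − c)·κ₀` (px11 ✓F2b); a datum `ν` with the row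
`‖ν y‖ ≤ μ₀·w·Σ_{B(y)}‖f(basePt + z)‖`, `w = (L^{−d})^{K−n}` (px11 (b-ℤ) (N)); the competitor `G z = φ z • R(axialFn Ṽ (ℓ·block z) z)⁻¹ ν(block z)` (px11's `hG` VERBATIM) read on the
torus as `fC = G ∘ ρ`.  THEN `Σ_b Σ_jk |(D^η_V fC)(b)_jk|² ≤ η⁻²·4·(d·A₁ + (2dℓκ₀)²·d·B₁)·μ₀²·w · Σ_x Σ_jk |f(x)_jk|²`.  Proof: ✓ `competitor_energy_le_of_datumRow` at `X := Site`,
`E := PBond`, `W := M₂(ℂ)` (operator norm), block label = the torus image of the block corner, transports = conjugations; then operator → entrywise norms (factor 2).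
[cite: Balaban1984PropagatorsII, (2.7)-(2.12) pp.224-225; Balaban1985BackgroundPropagators, (3.18)-(3.23) pp.393-394; Balaban1985Averaging, (8)-(9) p.18, (78)-(87) pp.30-31; Balaban1985RegularSpaces, (1.1) p.76] -/
theorem competitor_energy_member (F : T3Family) (n K : ℕ) (U₀ : GaugeField (F.P K) 0 (Matrix.specialUnitaryGroup (Fin 2) ℂ))
    (hℓ : 0 < (F.P K).L ^ (K - n)) (hdvd : (F.P K).L ^ (K - n) ∣ (F.P K).sitesPerDir 0) (h2ℓ : 2 * (F.P K).L ^ (K - n) ≤ (F.P K).sitesPerDir 0)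
    (ρ : Site (F.P K) 0 → LSite (F.P K).d) (hρ : ∀ (x : Site (F.P K) 0) (ν : Fin (F.P K).d), ρ x ν = (((x ν - basePt F n K ν).val : ℕ) : ℤ))
    (φ : LSite (F.P K).d → ℝ) (hφ0 : ∀ z, 0 ≤ φ z)
    (hφbd : ∀ (z : LSite (F.P K).d) (i : Fin (F.P K).d), (z i % ((F.P K).L ^ (K - n) : ℕ) = 0 ∨ z i % ((F.P K).L ^ (K - n) : ℕ) = ((F.P K).L ^ (K - n) : ℕ) - 1) → φ z = 0)
    {A₁ B₁ : ℝ} (hA₁ : 0 ≤ A₁) (hB₁ : 0 ≤ B₁)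
    (hφA : ∀ (y : LSite (F.P K).d) (μ : Fin (F.P K).d), ∑ z ∈ blockSites ((F.P K).L ^ (K - n)) y, (φ (z + e μ) - φ z) ^ 2 ≤ A₁)
    (hφB : ∀ y : LSite (F.P K).d, ∑ z ∈ blockSites ((F.P K).L ^ (K - n)) y, φ z ^ 2 ≤ B₁)
    {κ₀ : ℝ} (hκ₀ : 0 ≤ κ₀)
    (hκ : ∀ (c z : LSite (F.P K).d) (μ : Fin (F.P K).d),
      ‖((gaugeAct (axialFn (pull (bgUnits F K U₀) (basePt F n K)) c) (pull (bgUnits F K U₀) (basePt F n K)) z μ : (Matrix (Fin 2) (Fin 2) ℂ)ˣ) : Matrix (Fin 2) (Fin 2) ℂ) - 1‖ ≤ l1 (z - c) * κ₀)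
    (f : Site (F.P K) 0 → Matrix (Fin 2) (Fin 2) ℂ) (ν : LSite (F.P K).d → Matrix (Fin 2) (Fin 2) ℂ) {μ₀ : ℝ} (hμ₀ : 0 ≤ μ₀)
    (hν : ∀ y : LSite (F.P K).d, ‖ν y‖ ≤ μ₀ * (((((F.P K).L : ℝ) ^ (F.P K).d)⁻¹) ^ (K - n) * ∑ z ∈ blockSites ((F.P K).L ^ (K - n)) y, ‖f (transl (basePt F n K) z)‖))
    (G : LSite (F.P K).d → Matrix (Fin 2) (Fin 2) ℂ)
    (hG : ∀ z, G z = φ z • conjR (axialFn (pull (bgUnits F K U₀) (basePt F n K)) ((((F.P K).L ^ (K - n) : ℕ) : ℤ) • blockMap ((F.P K).L ^ (K - n)) z) z)⁻¹ (ν (blockMap ((F.P K).L ^ (K - n)) z)))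
    (fC : Site (F.P K) 0 → Matrix (Fin 2) (Fin 2) ℂ) (hfC : ∀ x, fC x = G (ρ x)) :
    ∑ b : PBond (F.P K) 0, ∑ j : Fin 2, ∑ k : Fin 2, ‖(covDerivFwdT (eta F n K) (bgUnits F K U₀) b.dir fC b.src) j k‖ ^ 2
      ≤ (eta F n K)⁻¹ ^ 2 * (4 * ((F.P K).d * A₁ + (2 * ((F.P K).d * ((F.P K).L ^ (K - n) : ℕ) * κ₀)) ^ 2 * ((F.P K).d * B₁)) * μ₀ ^ 2
          * ((((F.P K).L : ℝ) ^ (F.P K).d)⁻¹) ^ (K - n))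
        * ∑ x : Site (F.P K) 0, ∑ j : Fin 2, ∑ k : Fin 2, ‖f x j k‖ ^ 2 := by
  classical
  -- letters
  set ℓ : ℕ := (F.P K).L ^ (K - n) with hℓdef
  set V := bgUnits F K U₀ with hVdef
  set Vt := pull V (basePt F n K) with hVt
  set w : ℝ := ((((F.P K).L : ℝ) ^ (F.P K).d)⁻¹) ^ (K - n) with hw
  have hℓZ : (0 : ℤ) < ℓ := by exact_mod_cast hℓ
  have hw0 : 0 ≤ w := by rw [hw]; positivity
  have hV1 : ∀ b : PBond (F.P K) 0, V b ∈ U1 (Matrix (Fin 2) (Fin 2) ℂ) := fun b => unitsField_toUField_mem_U1 U₀ b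
  have hVt1 : ∀ (z : LSite (F.P K).d) (κ : Fin (F.P K).d), Vt z κ ∈ U1 (Matrix (Fin 2) (Fin 2) ℂ) := fun z κ => hV1 _
  -- the F1-core data
  let blk : Site (F.P K) 0 → Site (F.P K) 0 := fun x => transl (basePt F n K) ((ℓ : ℤ) • blockMap ℓ (ρ x))
  let a : Site (F.P K) 0 → (Matrix (Fin 2) (Fin 2) ℂ)ˣ := fun x => axialFn Vt ((ℓ : ℤ) • blockMap ℓ (ρ x)) (ρ x)
  have ha1 : ∀ x, a x ∈ U1 (Matrix (Fin 2) (Fin 2) ℂ) := fun x => hol_mem hVt1 _ _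
  let τ : PBond (F.P K) 0 → Matrix (Fin 2) (Fin 2) ℂ →L[ℂ] Matrix (Fin 2) (Fin 2) ℂ :=
    fun b => LinearMap.toContinuousLinearMap (LinearMap.mulLeftRight ℂ ((V b : Matrix (Fin 2) (Fin 2) ℂ), (((V b)⁻¹ : (Matrix (Fin 2) (Fin 2) ℂ)ˣ) : Matrix (Fin 2) (Fin 2) ℂ)))
  let σ : Site (F.P K) 0 → Matrix (Fin 2) (Fin 2) ℂ →L[ℂ] Matrix (Fin 2) (Fin 2) ℂ :=
    fun x => LinearMap.toContinuousLinearMap (LinearMap.mulLeftRight ℂ ((a x : Matrix (Fin 2) (Fin 2) ℂ), (((a x)⁻¹ : (Matrix (Fin 2) (Fin 2) ℂ)ˣ) : Matrix (Fin 2) (Fin 2) ℂ)))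
  let σ' : Site (F.P K) 0 → Matrix (Fin 2) (Fin 2) ℂ →L[ℂ] Matrix (Fin 2) (Fin 2) ℂ :=
    fun x => LinearMap.toContinuousLinearMap (LinearMap.mulLeftRight ℂ ((((a x)⁻¹ : (Matrix (Fin 2) (Fin 2) ℂ)ˣ) : Matrix (Fin 2) (Fin 2) ℂ), (a x : Matrix (Fin 2) (Fin 2) ℂ)))
  have hτapp : ∀ b v, τ b v = conjR (V b) v := fun b v => rfl
  have hσapp : ∀ x v, σ x v = conjR (a x) v := fun x v => rfl
  have hσ'app : ∀ x v, σ' x v = conjR (a x)⁻¹ v := fun x v => by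
    show (((a x)⁻¹ : (Matrix (Fin 2) (Fin 2) ℂ)ˣ) : Matrix (Fin 2) (Fin 2) ℂ) * v * (a x : Matrix (Fin 2) (Fin 2) ℂ) = _
    rw [conjR_apply, inv_inv]
  let νT : Site (F.P K) 0 → Matrix (Fin 2) (Fin 2) ℂ := fun y => if ∃ x₀, blk x₀ = y then ν (blockMap ℓ (ρ y)) else 0
  -- rows
  have hτ : ∀ b v, ‖τ b v‖ ≤ ‖v‖ := fun b v => by rw [hτapp]; exact norm_conjR_le (hV1 b) v
  have hσ'n : ∀ x v, ‖σ' x v‖ ≤ ‖v‖ := fun x v => by rw [hσ'app]; exact norm_conjR_le ((U1 _).inv_mem (ha1 x)) v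
  have hσ'σ : ∀ x u, σ' x (σ x u) = u := fun x u => by rw [hσ'app, hσapp]; exact conjR_inv_conjR _ _
  have hblk_iff : ∀ x x', blk x = blk x' ↔ blockMap ℓ (ρ x) = blockMap ℓ (ρ x') := fun x x' => cornerLabel_eq_iff (basePt F n K) ρ hρ hℓ x x'
  -- boundary layer ⇒ inter-block bonds carry no bubble
  have hinter : ∀ b : PBond (F.P K) 0, blk b.src ≠ blk (b.src.shift b.dir) → φ (ρ b.src) = 0 ∧ φ (ρ (b.src.shift b.dir)) = 0 := by
    intro b hne
    have hbm : blockMap ℓ (ρ (b.src.shift b.dir)) ≠ blockMap ℓ (ρ b.src) := fun h => hne ((hblk_iff _ _).2 h.symm)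
    have hlay : ρ b.src b.dir % (ℓ : ℤ) = (ℓ : ℤ) - 1 := by
      by_contra h
      exact hbm (blockMap_cellRepr_shift_of_emod_ne (basePt F n K) ρ hρ hℓ hdvd b.src b.dir h)
    refine ⟨hφbd _ b.dir (Or.inr hlay), ?_⟩
    rw [bubble_cellRepr_shift_eq (basePt F n K) ρ hρ hℓ hdvd φ hφbd b.src b.dir]
    exact hφbd _ b.dir (Or.inl (emod_add_e_eq_zero_of_emod_eq_pred hℓ (ρ b.src) b.dir hlay))
  -- the holonomy row from (κ)
  have hhol : ∀ b : PBond (F.P K) 0, blk b.src = blk (b.src.shift b.dir) →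
      ∀ v, ‖σ b.src (τ b (σ' (b.src.shift b.dir) v)) - v‖ ≤ (2 * ((F.P K).d * (ℓ : ℝ) * κ₀)) * ‖v‖ := by
    intro b hb v
    have hbm : blockMap ℓ (ρ (b.src.shift b.dir)) = blockMap ℓ (ρ b.src) := ((hblk_iff _ _).1 hb).symm
    have hne : ρ b.src b.dir % (ℓ : ℤ) ≠ (ℓ : ℤ) - 1 := fun h => blockMap_cellRepr_shift_ne_of_emod_eq (basePt F n K) ρ hρ hℓ hdvd h2ℓ b.src b.dir h hbm
    have hshift : ρ (b.src.shift b.dir) = ρ b.src + e b.dir := cellRepr_shift_of_emod_ne (basePt F n K) ρ hρ hℓ hdvd b.src b.dir hne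
    rw [hσapp, hτapp, hσ'app, conjR_conjR, conjR_conjR]
    -- the product is the comb-gauged background on the bond
    have hprod : a b.src * V b * (a (b.src.shift b.dir))⁻¹
        = gaugeAct (axialFn Vt ((ℓ : ℤ) • blockMap ℓ (ρ b.src))) Vt (ρ b.src) b.dir := by
      have hVb : V b = Vt (ρ b.src) b.dir := by
        rw [hVt, pull_apply, transl_cellRepr (basePt F n K) ρ hρ]
      simp only [a]
      rw [hbm, hshift, hVb]
      rfl
    rw [hprod]
    have hU : gaugeAct (axialFn Vt ((ℓ : ℤ) • blockMap ℓ (ρ b.src))) Vt (ρ b.src) b.dir ∈ U1 (Matrix (Fin 2) (Fin 2) ℂ) := by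
      rw [← hprod]; exact (U1 _).mul_mem ((U1 _).mul_mem (ha1 _) (hV1 b)) ((U1 _).inv_mem (ha1 _))
    refine (norm_conjR_sub_self_le hU v).trans ?_
    have h1 := hκ ((ℓ : ℤ) • blockMap ℓ (ρ b.src)) (ρ b.src) b.dir
    have h2 := l1_sub_corner_le ρ hℓ b.src
    have h3 : ‖((gaugeAct (axialFn Vt ((ℓ : ℤ) • blockMap ℓ (ρ b.src))) Vt (ρ b.src) b.dir : (Matrix (Fin 2) (Fin 2) ℂ)ˣ) : Matrix (Fin 2) (Fin 2) ℂ) - 1‖ ≤ (F.P K).d * (ℓ : ℝ) * κ₀ :=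
      h1.trans (by nlinarith)
    nlinarith [norm_nonneg v]
  -- the block sums (R-A), (R-B)
  have hfib : ∀ (y : Site (F.P K) 0) (x₀ : Site (F.P K) 0), blk x₀ = y →
      univ.filter (fun x => blk x = y) = univ.filter (fun x => blockMap ℓ (ρ x) = blockMap ℓ (ρ x₀)) := by
    intro y x₀ hx₀
    ext x
    simp only [mem_filter, mem_univ, true_and]
    rw [← hx₀]; exact hblk_iff x x₀
  have hfib0 : ∀ y : Site (F.P K) 0, (¬ ∃ x₀, blk x₀ = y) → univ.filter (fun x => blk x = y) = ∅ := by
    intro y hy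
    ext x
    simp only [mem_filter, mem_univ, true_and, Finset.notMem_empty, iff_false]
    exact fun h => hy ⟨x, h⟩
  have hA : ∀ y : Site (F.P K) 0, ∑ b ∈ univ.filter (fun b : PBond (F.P K) 0 => blk b.src = y), (φ (ρ (b.src.shift b.dir)) - φ (ρ b.src)) ^ 2 ≤ (F.P K).d * A₁ := by
    intro y
    rw [sum_pbond_filter (fun x => blk x = y)]
    by_cases hy : ∃ x₀, blk x₀ = y
    · obtain ⟨x₀, hx₀⟩ := hy
      rw [hfib y x₀ hx₀]
      have e1 : ∀ x ∈ univ.filter (fun x => blockMap ℓ (ρ x) = blockMap ℓ (ρ x₀)),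
          ∑ μ : Fin (F.P K).d, (φ (ρ (x.shift μ)) - φ (ρ x)) ^ 2 = ∑ μ : Fin (F.P K).d, (φ (ρ x + e μ) - φ (ρ x)) ^ 2 := by
        intro x _
        exact sum_congr rfl fun μ _ => by rw [bubble_cellRepr_shift_eq (basePt F n K) ρ hρ hℓ hdvd φ hφbd x μ]
      rw [sum_congr rfl e1, sum_fibre_eq_sum_blockSites (basePt F n K) ρ hρ hℓ hdvd (fun x => ∑ μ : Fin (F.P K).d, (φ (ρ x + e μ) - φ (ρ x)) ^ 2) x₀]
      have e2 : ∀ z ∈ blockSites ℓ (blockMap ℓ (ρ x₀)),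
          ∑ μ : Fin (F.P K).d, (φ (ρ (transl (basePt F n K) z) + e μ) - φ (ρ (transl (basePt F n K) z))) ^ 2 = ∑ μ : Fin (F.P K).d, (φ (z + e μ) - φ z) ^ 2 := by
        intro z hz
        rw [cellRepr_transl_of_mem_cell (basePt F n K) ρ hρ z (mem_cell_of_mem_blockSites (basePt F n K) ρ hρ hℓ hdvd x₀ z hz)]
      rw [sum_congr rfl e2, sum_comm]
      calc ∑ μ : Fin (F.P K).d, ∑ z ∈ blockSites ℓ (blockMap ℓ (ρ x₀)), (φ (z + e μ) - φ z) ^ 2 ≤ ∑ _μ : Fin (F.P K).d, A₁ :=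
            sum_le_sum fun μ _ => hφA _ μ
        _ = (F.P K).d * A₁ := by rw [sum_const, card_univ, Fintype.card_fin, nsmul_eq_mul]
    · rw [hfib0 y hy, sum_empty]; positivity
  have hB : ∀ y : Site (F.P K) 0, ∑ b ∈ univ.filter (fun b : PBond (F.P K) 0 => blk b.src = y), φ (ρ b.src) ^ 2 ≤ (F.P K).d * B₁ := by
    intro y
    rw [sum_pbond_filter (fun x => blk x = y)]
    by_cases hy : ∃ x₀, blk x₀ = y
    · obtain ⟨x₀, hx₀⟩ := hy
      rw [hfib y x₀ hx₀, sum_fibre_eq_sum_blockSites (basePt F n K) ρ hρ hℓ hdvd (fun x => ∑ _μ : Fin (F.P K).d, φ (ρ x) ^ 2) x₀]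
      have e2 : ∀ z ∈ blockSites ℓ (blockMap ℓ (ρ x₀)),
          ∑ _μ : Fin (F.P K).d, φ (ρ (transl (basePt F n K) z)) ^ 2 = (F.P K).d * φ z ^ 2 := by
        intro z hz
        rw [cellRepr_transl_of_mem_cell (basePt F n K) ρ hρ z (mem_cell_of_mem_blockSites (basePt F n K) ρ hρ hℓ hdvd x₀ z hz), sum_const, card_univ,
          Fintype.card_fin, nsmul_eq_mul]
      rw [sum_congr rfl e2, ← mul_sum]
      exact mul_le_mul_of_nonneg_left (hφB _) (Nat.cast_nonneg _)
    · rw [hfib0 y hy, sum_empty]; positivity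
  -- the block cardinality: `w·ℓ^d = 1`
  have hwℓ : w * ((ℓ : ℕ) : ℝ) ^ (F.P K).d = 1 := by
    rw [hw, hℓdef]
    push_cast
    rw [← pow_mul, mul_comm (K - n) (F.P K).d, pow_mul, ← mul_pow]
    by_cases hL : ((F.P K).L : ℝ) ^ (F.P K).d = 0
    · -- then `L = 0` (and `d ≠ 0`), and `0 < L^{K−n}` forces `K − n = 0`
      obtain ⟨hL0, -⟩ := pow_eq_zero_iff'.mp hL
      have hL0' : (F.P K).L = 0 := by exact_mod_cast hL0
      have hk : K - n = 0 := by
        by_contra hk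
        rw [hℓdef, hL0', zero_pow hk] at hℓ
        exact lt_irrefl 0 hℓ
      rw [hk, pow_zero]
    · rw [inv_mul_cancel₀ hL, one_pow]
  have hcard : ∀ y : Site (F.P K) 0, w * ((univ.filter (fun x => blk x = y)).card : ℝ) ≤ 1 := by
    intro y
    by_cases hy : ∃ x₀, blk x₀ = y
    · obtain ⟨x₀, hx₀⟩ := hy
      rw [hfib y x₀ hx₀, card_fibre_eq (basePt F n K) ρ hρ hℓ hdvd x₀, hwℓ]
    · rw [hfib0 y hy, card_empty]; simp
  -- the datum row, read on the torus labels
  have hνT_of : ∀ x₀ : Site (F.P K) 0, νT (blk x₀) = ν (blockMap ℓ (ρ x₀)) := by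
    intro x₀
    have hex : ∃ x, blk x = blk x₀ := ⟨x₀, rfl⟩
    show (if ∃ x, blk x = blk x₀ then ν (blockMap ℓ (ρ (blk x₀))) else 0) = _
    rw [if_pos hex, blockMap_cellRepr_cornerLabel (basePt F n K) ρ hρ hℓ x₀]
  have hνle : ∀ y : Site (F.P K) 0, ‖νT y‖ ≤ μ₀ * (w * ∑ x ∈ univ.filter (fun x => blk x = y), ‖f x‖) := by
    intro y
    by_cases hy : ∃ x₀, blk x₀ = y
    · obtain ⟨x₀, hx₀⟩ := hy
      rw [← hx₀, hνT_of x₀, hfib (blk x₀) x₀ rfl, sum_fibre_eq_sum_blockSites (basePt F n K) ρ hρ hℓ hdvd (fun x => ‖f x‖) x₀]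
      exact hν _
    · have h0 : νT y = 0 := by
        show (if ∃ x, blk x = y then ν (blockMap ℓ (ρ y)) else 0) = 0
        rw [if_neg hy]
      rw [h0, norm_zero]
      exact mul_nonneg hμ₀ (mul_nonneg hw0 (sum_nonneg fun _ _ => norm_nonneg _))
  -- the competitor in F1-core's letters
  have hfC' : ∀ x, fC x = ((φ (ρ x) : ℝ) : ℂ) • σ' x (νT (blk x)) := by
    intro x
    rw [hfC, hG, hνT_of x, hσ'app, real_smul_eq_coe_smul]
  -- ✓ F1-core
  have key := competitor_energy_le_of_datumRow blk (fun b : PBond (F.P K) 0 => b.src) (fun b => b.src.shift b.dir) τ σ σ' (fun x => φ (ρ x)) w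
    (fun x => hφ0 _) hτ hσ'n hσ'σ hinter hw0 hA hB hhol hcard f νT hνle fC hfC'
  -- conversion: operator norm ↔ entrywise sums (factor 2), and the `η⁻¹` of `D^η`
  have hη : 0 < eta F n K := eta_pos F n K
  have hlhs : ∀ b : PBond (F.P K) 0, ∑ j : Fin 2, ∑ k : Fin 2, ‖(covDerivFwdT (eta F n K) V b.dir fC b.src) j k‖ ^ 2
      ≤ (eta F n K)⁻¹ ^ 2 * (2 * ‖τ b (fC (b.src.shift b.dir)) - fC b.src‖ ^ 2) := by
    intro b
    have e : covDerivFwdT (eta F n K) V b.dir fC b.src = (eta F n K)⁻¹ • (τ b (fC (b.src.shift b.dir)) - fC b.src) := by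
      rw [hτapp]; rfl
    rw [e]
    have h2 := sum_norm_sq_le_mul_opNorm_sq (N := 2) (τ b (fC (b.src.shift b.dir)) - fC b.src)
    have hsm : ∀ j k : Fin 2, ‖((eta F n K)⁻¹ • (τ b (fC (b.src.shift b.dir)) - fC b.src)) j k‖ ^ 2
        = (eta F n K)⁻¹ ^ 2 * ‖(τ b (fC (b.src.shift b.dir)) - fC b.src) j k‖ ^ 2 := by
      intro j k
      rw [Matrix.smul_apply, norm_smul, Real.norm_of_nonneg (inv_nonneg.mpr hη.le), mul_pow]
    simp_rw [hsm, ← mul_sum]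
    refine mul_le_mul_of_nonneg_left ?_ (by positivity)
    exact_mod_cast h2
  have hrhs : ∑ x : Site (F.P K) 0, ‖f x‖ ^ 2 ≤ ∑ x : Site (F.P K) 0, ∑ j : Fin 2, ∑ k : Fin 2, ‖f x j k‖ ^ 2 :=
    sum_le_sum fun x _ => MatrixNorms.opNorm_sq_le_sum_norm_sq (f x)
  have hC0 : 0 ≤ (4 * ((F.P K).d * A₁ + (2 * ((F.P K).d * ((ℓ : ℕ) : ℝ) * κ₀)) ^ 2 * ((F.P K).d * B₁)) * μ₀ ^ 2 * w) := by positivity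
  calc ∑ b : PBond (F.P K) 0, ∑ j : Fin 2, ∑ k : Fin 2, ‖(covDerivFwdT (eta F n K) V b.dir fC b.src) j k‖ ^ 2
      ≤ ∑ b : PBond (F.P K) 0, (eta F n K)⁻¹ ^ 2 * (2 * ‖τ b (fC (b.src.shift b.dir)) - fC b.src‖ ^ 2) := sum_le_sum fun b _ => hlhs b
    _ = (eta F n K)⁻¹ ^ 2 * (2 * ∑ b : PBond (F.P K) 0, ‖τ b (fC (b.src.shift b.dir)) - fC b.src‖ ^ 2) := by rw [← mul_sum, ← mul_sum]
    _ ≤ (eta F n K)⁻¹ ^ 2 * (2 * (2 * ((F.P K).d * A₁ + (2 * ((F.P K).d * (ℓ : ℝ) * κ₀)) ^ 2 * ((F.P K).d * B₁)) * μ₀ ^ 2 * w * ∑ x : Site (F.P K) 0, ‖f x‖ ^ 2)) := by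
        gcongr
    _ ≤ (eta F n K)⁻¹ ^ 2 * (4 * ((F.P K).d * A₁ + (2 * ((F.P K).d * ((ℓ : ℕ) : ℝ) * κ₀)) ^ 2 * ((F.P K).d * B₁)) * μ₀ ^ 2 * w)
          * ∑ x : Site (F.P K) 0, ∑ j : Fin 2, ∑ k : Fin 2, ‖f x j k‖ ^ 2 := by
        have := mul_le_mul_of_nonneg_left hrhs hC0
        have hη2 : 0 ≤ (eta F n K)⁻¹ ^ 2 := by positivity
        nlinarith [mul_le_mul_of_nonneg_left this hη2]

end Member

end Summit.QuantumFields.YangMills.Theorems.Prop7CompetitorEnergyMember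

end
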